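import Mathlib.LinearAlgebra.Matrix.SchurComplement
import Literature.MathematicalPhysics.QuantumLattice.GrassmannIntegral

/-!
# Sylvester (Weinstein–Aronszajn) defect identity for the Wilson–Dirac operator
(crux `QuarksAsStableAction.StableActionBridge`, item stmt-QuantumFields-9737, line `Sketch`; lead helper,
`--supports stmt-QuantumFields-9737`; the statement is ideator 2's `SylvesterDefectIdentity`, card `sylvester-defect-floor`)

For two gauge fields `U, U'` on the four-torus and any representation `ρ`, the Wilson–Dirac operators
`D = D_W[U]`, `D' = D_W[U']` (tree `wilsonDirac ρ · m r`, same `m, r`) differ by a matrix `V = D − D'` which is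
SUPPORTED ON THE DEFECT SET `Z̄ = {x : some link touching x differs}`: a hopping entry `(p, q)` of `D_W` involves
exactly one link, and if that link is unchanged the two entries agree (`wilsonDirac_sub_apply_eq_zero_of_left/right`),
so `V = χ V χ` for the `0/1` diagonal projection `χ` onto `Z̄` (`defect_sandwich`).  Consequently, for invertible `D'`,

  `det D = det D' · det(1 + χ (D − D') D'⁻¹ χ)`      (`det_wilsonDirac_eq_det_mul_det_defect`)

by `det(1 + AB) = det(1 + BA)` (Weinstein–Aronszajn; Mathlib `Matrix.det_one_add_mul_comm`): the whole dependence
of the determinant on the changed links is carried by the `Z̄ × Z̄` block `χ D'⁻¹ χ` of the PATCHED field's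
propagator.  This is the algebraic atom of the smooth-patch domination lever (card `sylvester-defect-floor` §Lever)
and of the route's foreseen `DefectLocality` child of `WilsonQuarkStability`.  Pure finite linear algebra; no new
definitions (the defect predicate and the projection are written out, with classical decidability, exactly as in
ideator 2's statement).
-/

namespace Summit.QuantumFields.QCD.Cruxes.StableActionBridge.Sketch

open Literature.MathematicalPhysics.QuantumLattice Literature.MathematicalPhysics.QuantumFieldTheory
open Literature.Probability.LatticeModels (TorusSite)

variable {N L : ℕ} {G : Type*} [Group G] (ρ : G →* Matrix (Fin N) (Fin N) ℂ)

omit [Group G] in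
/-- If `y = x + e_μ` on the torus then `x = y − e_μ`. -/
private theorem eq_sub_single_of_eq_shift {x y : TorusSite 4 L} {μ : Fin 4}
    (h : y = Site.shift x μ) : x = y - Pi.single μ 1 := by
  rw [h, Site.shift, add_sub_cancel_right]

/-- **Row support.** If no link touching the site of `p` differs between `U` and `U'`, the `p`-th ROW of
`D_W[U] − D_W[U']` vanishes. -/
theorem wilsonDirac_sub_apply_eq_zero_of_left (U U' : GaugeConfig 4 L G) (m r : ℝ)
    (p q : TorusSite 4 L × Fin N × Fin 4)
    (hp : ¬ ((∃ μ : Fin 4, U (p.1, μ) ≠ U' (p.1, μ)) ∨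
      (∃ μ : Fin 4, U (p.1 - Pi.single μ 1, μ) ≠ U' (p.1 - Pi.single μ 1, μ)))) :
    (wilsonDirac ρ U m r - wilsonDirac ρ U' m r) p q = 0 := by
  simp only [not_or, not_exists, not_not] at hp
  obtain ⟨h1, h2⟩ := hp
  rw [Matrix.sub_apply, sub_eq_zero]
  simp only [wilsonDirac, Matrix.of_apply]
  congr 1
  congr 1
  refine Finset.sum_congr rfl fun μ _ => ?_
  congr 1
  · rw [h1 μ]
  · split_ifs with hpq
    · rw [show U (q.1, μ) = U' (q.1, μ) from by
        rw [eq_sub_single_of_eq_shift hpq]; exact h2 μ]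
    · rfl

/-- **Column support.** If no link touching the site of `q` differs between `U` and `U'`, the `q`-th COLUMN
of `D_W[U] − D_W[U']` vanishes. -/
theorem wilsonDirac_sub_apply_eq_zero_of_right (U U' : GaugeConfig 4 L G) (m r : ℝ)
    (p q : TorusSite 4 L × Fin N × Fin 4)
    (hq : ¬ ((∃ μ : Fin 4, U (q.1, μ) ≠ U' (q.1, μ)) ∨
      (∃ μ : Fin 4, U (q.1 - Pi.single μ 1, μ) ≠ U' (q.1 - Pi.single μ 1, μ)))) :
    (wilsonDirac ρ U m r - wilsonDirac ρ U' m r) p q = 0 := by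
  simp only [not_or, not_exists, not_not] at hq
  obtain ⟨h1, h2⟩ := hq
  rw [Matrix.sub_apply, sub_eq_zero]
  simp only [wilsonDirac, Matrix.of_apply]
  congr 1
  congr 1
  refine Finset.sum_congr rfl fun μ _ => ?_
  congr 1
  · split_ifs with hqp
    · rw [show U (p.1, μ) = U' (p.1, μ) from by
        rw [eq_sub_single_of_eq_shift hqp]; exact h2 μ]
    · rfl
  · rw [h1 μ]

open Classical in
/-- **Support of the difference**: `χ (D − D') χ = D − D'` for the `0/1` diagonal projection `χ` onto the
defect set (indices whose site touches a changed link). -/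
theorem defect_sandwich [NeZero L] (U U' : GaugeConfig 4 L G) (m r : ℝ) :
    let χ : Matrix (TorusSite 4 L × Fin N × Fin 4) (TorusSite 4 L × Fin N × Fin 4) ℂ :=
      Matrix.diagonal fun p =>
        if (∃ μ : Fin 4, U (p.1, μ) ≠ U' (p.1, μ)) ∨
            (∃ μ : Fin 4, U (p.1 - Pi.single μ 1, μ) ≠ U' (p.1 - Pi.single μ 1, μ))
        then 1 else 0;
    χ * (wilsonDirac ρ U m r - wilsonDirac ρ U' m r) * χ = wilsonDirac ρ U m r - wilsonDirac ρ U' m r := by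
  intro χ
  ext p q
  rw [Matrix.mul_diagonal, Matrix.diagonal_mul]
  by_cases hp : (∃ μ : Fin 4, U (p.1, μ) ≠ U' (p.1, μ)) ∨
      (∃ μ : Fin 4, U (p.1 - Pi.single μ 1, μ) ≠ U' (p.1 - Pi.single μ 1, μ))
  · by_cases hq : (∃ μ : Fin 4, U (q.1, μ) ≠ U' (q.1, μ)) ∨
        (∃ μ : Fin 4, U (q.1 - Pi.single μ 1, μ) ≠ U' (q.1 - Pi.single μ 1, μ))
    · rw [if_pos hp, if_pos hq, one_mul, mul_one]
    · rw [wilsonDirac_sub_apply_eq_zero_of_right ρ U U' m r p q hq, mul_zero, zero_mul]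
  · rw [wilsonDirac_sub_apply_eq_zero_of_left ρ U U' m r p q hp, mul_zero, zero_mul]

open Classical in
/-- **Sylvester / Weinstein–Aronszajn defect identity for the Wilson–Dirac operator** (ideator 2's
`SylvesterDefectIdentity`, card `sylvester-defect-floor`).  For gauge fields `U, U'` with `D = D_W[U]`,
`D' = D_W[U']` and `χ` the `0/1` diagonal projection onto the defect set, if `det D'` is a unit then
`det D = det D' · det(1 + χ (D − D') D'⁻¹ χ)`: only the `Z̄ × Z̄` block of the patched propagator `D'⁻¹` enters.
Proof: `D = D'(1 + D'⁻¹ V)` with `V = χ V χ` (`defect_sandwich`), then `det(1 + (D'⁻¹χ)(Vχ)) = det(1 + (Vχ)(D'⁻¹χ))`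
(`Matrix.det_one_add_mul_comm`) and `V χ = χ V`. -/
theorem det_wilsonDirac_eq_det_mul_det_defect [NeZero L] (U U' : GaugeConfig 4 L G) (m r : ℝ) :
    let D := wilsonDirac ρ U m r;
    let D' := wilsonDirac ρ U' m r;
    let χ : Matrix (TorusSite 4 L × Fin N × Fin 4) (TorusSite 4 L × Fin N × Fin 4) ℂ :=
      Matrix.diagonal fun p =>
        if (∃ μ : Fin 4, U (p.1, μ) ≠ U' (p.1, μ)) ∨
            (∃ μ : Fin 4, U (p.1 - Pi.single μ 1, μ) ≠ U' (p.1 - Pi.single μ 1, μ))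
        then 1 else 0;
    IsUnit D'.det → D.det = D'.det * (1 + χ * (D - D') * D'⁻¹ * χ).det := by
  intro D D' χ hD'
  set V := D - D' with hV
  have hsand : χ * V * χ = V := defect_sandwich ρ U U' m r
  have hχχ : χ * χ = χ := by
    rw [Matrix.diagonal_mul_diagonal]
    congr 1
    funext p
    split_ifs <;> simp
  -- `V χ = χ V` (both equal `χ V χ`)
  have hVχ : V * χ = χ * V * χ := by
    conv_lhs => rw [← hsand]
    rw [Matrix.mul_assoc (χ * V) χ χ, hχχ]
  have hχV : χ * V = χ * V * χ := by
    conv_lhs => rw [← hsand]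
    rw [← Matrix.mul_assoc, ← Matrix.mul_assoc, hχχ]
  -- `D = D' (1 + D'⁻¹ V)`
  have hfactor : D = D' * (1 + D'⁻¹ * V) := by
    rw [Matrix.mul_add, Matrix.mul_one, ← Matrix.mul_assoc, Matrix.mul_nonsing_inv _ hD', Matrix.one_mul,
      hV, add_sub_cancel]
  calc D.det = (D' * (1 + D'⁻¹ * V)).det := by rw [← hfactor]
    _ = D'.det * (1 + D'⁻¹ * V).det := Matrix.det_mul _ _
    _ = D'.det * (1 + D'⁻¹ * χ * (V * χ)).det := by
        rw [Matrix.mul_assoc (D'⁻¹) χ (V * χ), ← Matrix.mul_assoc χ V χ, hsand]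
    _ = D'.det * (1 + V * χ * (D'⁻¹ * χ)).det := by rw [Matrix.det_one_add_mul_comm]
    _ = D'.det * (1 + χ * V * D'⁻¹ * χ).det := by
        have hcomm : V * χ = χ * V := hVχ.trans hχV.symm
        rw [← Matrix.mul_assoc (V * χ) (D'⁻¹) χ, hcomm]

open Classical in
/-- **Sylvester defect identity, ideator 2's `SylvesterDefectIdentity` VERBATIM** (explicit binders
`∀ (N L : ℕ) [NeZero L] (G : Type) [Group G] ρ U U' m r`; registered sub-goal `sylvester_defect_identity` of
crux stmt-QuantumFields-9737): `IsUnit (det D') → det D = det D' · det(1 + χ (D − D') D'⁻¹ χ)`. -/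
theorem sylvester_defect_identity :
    ∀ (N L : ℕ) [NeZero L] (G : Type) [Group G] (ρ : G →* Matrix (Fin N) (Fin N) ℂ)
      (U U' : GaugeConfig 4 L G) (m r : ℝ),
      let D := wilsonDirac ρ U m r;
      let D' := wilsonDirac ρ U' m r;
      let χ : Matrix (TorusSite 4 L × Fin N × Fin 4) (TorusSite 4 L × Fin N × Fin 4) ℂ :=
        Matrix.diagonal fun p =>
          if (∃ μ : Fin 4, U (p.1, μ) ≠ U' (p.1, μ)) ∨
              (∃ μ : Fin 4, U (p.1 - Pi.single μ 1, μ) ≠ U' (p.1 - Pi.single μ 1, μ))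
          then 1 else 0;
      IsUnit D'.det → D.det = D'.det * (1 + χ * (D - D') * D'⁻¹ * χ).det :=
  fun _ _ _ _ _ ρ U U' m r => det_wilsonDirac_eq_det_mul_det_defect ρ U U' m r

end Summit.QuantumFields.QCD.Cruxes.StableActionBridge.Sketch
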